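import Summits.CriticalPhenomena.PercolationContinuityZ3.Theorems.SahiMasterFamilyPrincipalCapBeta

/-!
# Second-order positivity on the one-missing-face cone, EVERY order: complementary splits are dominated by
# near-complementary splits

Unit `prim-masterthm-p4` (gen 15; crux anchor stmt-CriticalPhenomena-4575, helper work; memo
`run/shared/lean/prim/prim-masterthm/prim-masterthm-p4/P4-GEN15-REPORT.md` §3).  Companion of `…PhiSymmetric` (`F(16)` is false:
the relaxation `PhiNonneg` forgets the face inequalities below) and `…PrincipalCapBeta` (`phiSet`, `PhiNonneg`).

SETTING (memo §1–§3).  In the small-defect regime `β = 1 − εx` (`x ≥ 0`, `x = 0` on the sets of size `≥ k−1`, which kills the first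
order) Sahi's functional expands as `Φ_k(1 − εx) = ε²·(P(x) − N(x)) + O(ε³)` with
`N = Σ_{{B,Bᶜ}} w_B w_{Bᶜ} x_B x_{Bᶜ}` (complementary 2-block splits of `[k]`) and `P = Σ_i Σ_{{C,C'} : C ⊔ C' = [k]−i} w_C w_{C'} x_C x_{C'}`
(2-block splits of the `[k]−i`), `w_B = (|B|−1)!`.  For the conditional-moment function of ANY event family (G-system: `β_S = μ(S ∈ 𝒢(ω))`,
`𝒢(ω)` union-closed) the defects satisfy the linear ONE-MISSING-FACE inequalities **`(|B|−1)·x_B ≤ Σ_{i∈B} x_{B∖i}`** (if `B ∉ 𝒢(ω)` then at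
most one `B∖i ∈ 𝒢(ω)`: `sum_indicator_erase_le_of_unionClosed`), whereas the abstract relaxation `X_k` only has supermultiplicativity —
and the order-16 witness of `…PhiSymmetric` violates them.

**THEOREM (this file, every `k`)** `sum_compl_le_sum_near`: for `x ≥ 0` on `Finset (Fin k)` vanishing on the sets of size `≥ k − 1` and
satisfying the face inequalities, `N(x) ≤ P(x)` (stated with ORDERED pairs on both sides, i.e. both doubled):
`Σ_B w_B w_{Bᶜ} x_B x_{Bᶜ} ≤ Σ_i Σ_{C ⊆ [k]−i} w_C w_{([k]−i)∖C} x_C x_{([k]−i)∖C}`.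
PROOF (smaller-side charging, memo §3): by the face inequality for the SMALLER side `B` of a complementary pair,
`w_B w_{Bᶜ} x_B x_{Bᶜ} ≤ Σ_{i∈B} w_{B∖i} w_{Bᶜ} x_{B∖i} x_{Bᶜ}` (`(|B|−1)!/(|B|−1) = (|B|−2)!`) — the weights of its near-complementary
children; ties (`|B| = |Bᶜ|`) are split half-half (`side`-weights `θ_B ∈ {0, ½, 1}`, `θ_B + θ_{Bᶜ} = 1`); a near-complementary pair
`{C, ([k]−i)∖C}` is produced only by re-inserting `i` into the side that is then the smaller one, so its total charge is
`θ_{C+i} + θ_{(([k]−i)∖C)+i} ≤ 1` (`side_insert_add_side_insert_le_one`).  No subadditivity is used.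
CONSEQUENCE / HONEST FRAMING: no principal-cap family (no G-system) is a counterexample to Sahi's `C_k` to second order in the defects,
for any `k`; the failure of `F(16)` is exactly the forgotten face structure.  This is a statement about the quadratic coefficient only —
Sahi's `C_k`, PC-k (`k ≥ 8`), Kahn's Conjecture 5 and the master theorem remain OPEN.  Axioms standard. [this work]
-/

noncomputable section

open scoped Classical

namespace Summit.CriticalPhenomena.PercolationContinuityZ3.Theorems

namespace PhiSecondOrder

open Finset

variable {k : ℕ}

/-! ### The source of the hypothesis: union-closed families satisfy the one-missing-face inequality pointwise -/

/-- If `𝒰` is closed under unions then `Σ_{i∈B} 1[B∖i ∈ 𝒰] ≤ 1 + (|B|−1)·1[B ∈ 𝒰]`: when `B ∉ 𝒰` at most ONE of the sets `B∖i` lies in `𝒰`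
(two of them have union `B`).  Averaging over `ω` gives `Σ_{i∈B} β_{B∖i} ≤ 1 + (|B|−1)β_B`, i.e. `(|B|−1)d_B ≤ Σ_i d_{B∖i}` for the defects
`d = 1 − β`, for every G-system / event family. [this work] -/
theorem sum_indicator_erase_le_of_unionClosed {ι : Type*} [DecidableEq ι] (𝒰 : Finset (Finset ι))
    (hU : ∀ A ∈ 𝒰, ∀ A' ∈ 𝒰, A ∪ A' ∈ 𝒰) (B : Finset ι) :
    ∑ i ∈ B, (if B.erase i ∈ 𝒰 then (1 : ℝ) else 0) ≤ 1 + ((B.card : ℝ) - 1) * (if B ∈ 𝒰 then 1 else 0) := by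
  by_cases hB : B ∈ 𝒰
  · rw [if_pos hB, mul_one]
    calc ∑ i ∈ B, (if B.erase i ∈ 𝒰 then (1 : ℝ) else 0) ≤ ∑ i ∈ B, (1 : ℝ) :=
          sum_le_sum fun i _ => by split_ifs <;> norm_num
      _ = 1 + ((B.card : ℝ) - 1) := by rw [sum_const, nsmul_eq_mul, mul_one]; ring
  · rw [if_neg hB, mul_zero, add_zero]
    -- at most one `i` with `B.erase i ∈ 𝒰`
    by_contra hlt
    push Not at hlt
    have h2 : ∃ i ∈ B, ∃ j ∈ B, i ≠ j ∧ B.erase i ∈ 𝒰 ∧ B.erase j ∈ 𝒰 := by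
      by_contra hno
      push Not at hno
      -- then the sum is ≤ 1
      have hle : ∑ i ∈ B, (if B.erase i ∈ 𝒰 then (1 : ℝ) else 0) ≤ 1 := by
        by_cases hex : ∃ i ∈ B, B.erase i ∈ 𝒰
        · obtain ⟨i, hi, hiU⟩ := hex
          rw [← add_sum_erase B _ hi, if_pos hiU]
          have hrest : ∑ j ∈ B.erase i, (if B.erase j ∈ 𝒰 then (1 : ℝ) else 0) = 0 := by
            refine sum_eq_zero fun j hj => ?_
            have hji : j ≠ i := (mem_erase.1 hj).1
            have hjB : j ∈ B := (mem_erase.1 hj).2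
            rw [if_neg (hno i hi j hjB hji.symm hiU)]
          rw [hrest, add_zero]
        · push Not at hex
          calc ∑ i ∈ B, (if B.erase i ∈ 𝒰 then (1 : ℝ) else 0) = ∑ i ∈ B, (0 : ℝ) :=
                sum_congr rfl fun i hi => if_neg (hex i hi)
            _ ≤ 1 := by rw [sum_const_zero]; norm_num
      exact absurd hle (not_le.2 hlt)
    obtain ⟨i, hi, j, hj, hij, hiU, hjU⟩ := h2
    have hun : B.erase i ∪ B.erase j = B := by
      ext y
      simp only [mem_union, mem_erase, ne_eq]
      constructor
      · rintro (⟨-, hy⟩ | ⟨-, hy⟩) <;> exact hy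
      · intro hy
        by_cases hyi : y = i
        · exact Or.inr ⟨fun h => hij (hyi ▸ h), hy⟩
        · exact Or.inl ⟨hyi, hy⟩
    exact hB (hun ▸ hU _ hiU _ hjU)

/-! ### Weights and the face step -/

/-- `(|B|−1)! = (|B|−1)·(|B∖i|−1)!` for `i ∈ B`, `|B| ≥ 2`. [folklore] -/
theorem factorial_card_sub_one {ι : Type*} [DecidableEq ι] {B : Finset ι} (hB : 2 ≤ B.card) {i : ι} (hi : i ∈ B) :
    ((B.card - 1).factorial : ℝ) = ((B.card : ℝ) - 1) * (((B.erase i).card - 1).factorial : ℝ) := by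
  rw [card_erase_of_mem hi]
  obtain ⟨m, hm⟩ : ∃ m, B.card = m + 2 := ⟨B.card - 2, by omega⟩
  rw [hm]
  have e1 : m + 2 - 1 = (m + 1) := by omega
  have e2 : m + 1 - 1 = m := by omega
  rw [e1, e2, Nat.factorial_succ]
  push_cast
  ring

/-- **Face step.**  Under the one-missing-face inequality for `B` (`|B| ≥ 2`), `w_B x_B ≤ Σ_{i∈B} w_{B∖i} x_{B∖i}`. [this work] -/
theorem weight_mul_le_sum_erase (x : Finset (Fin k) → ℝ) {B : Finset (Fin k)} (hB : 2 ≤ B.card)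
    (hface : ((B.card : ℝ) - 1) * x B ≤ ∑ i ∈ B, x (B.erase i)) :
    ((B.card - 1).factorial : ℝ) * x B ≤ ∑ i ∈ B, (((B.erase i).card - 1).factorial : ℝ) * x (B.erase i) := by
  have hm : ∀ i ∈ B, (((B.erase i).card - 1).factorial : ℝ) = ((B.card - 2).factorial : ℝ) := by
    intro i hi; rw [card_erase_of_mem hi]; rfl
  rw [sum_congr rfl fun i hi => by rw [hm i hi], ← mul_sum]
  obtain ⟨i₀, hi₀⟩ : B.Nonempty := card_pos.1 (by omega)
  rw [factorial_card_sub_one hB hi₀, hm i₀ hi₀, mul_assoc, mul_comm ((B.card : ℝ) - 1), mul_assoc]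
  exact mul_le_mul_of_nonneg_left (by rw [mul_comm]; exact hface) (Nat.cast_nonneg _)

/-! ### Side weights -/

/-- `θ_B ∈ {1, ½, 0}` according as `|B| <, =, > |Bᶜ|`. [this work] -/
theorem side_nonneg (k b : ℕ) : (0 : ℝ) ≤ (if 2 * b < k then 1 else if 2 * b = k then 1 / 2 else 0) := by
  split_ifs <;> norm_num

/-- `θ_B + θ_{Bᶜ} = 1`. [this work] -/
theorem side_add_side_compl {b : ℕ} (hb : b ≤ k) :
    (if 2 * b < k then (1 : ℝ) else if 2 * b = k then 1 / 2 else 0) +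
      (if 2 * (k - b) < k then (1 : ℝ) else if 2 * (k - b) = k then 1 / 2 else 0) = 1 := by
  by_cases h1 : 2 * b < k
  · rw [if_pos h1, if_neg (by omega), if_neg (by omega)]; norm_num
  · by_cases h2 : 2 * b = k
    · rw [if_neg h1, if_pos h2, if_neg (by omega), if_pos (by omega)]; norm_num
    · rw [if_neg h1, if_neg h2, if_pos (by omega)]; norm_num

/-- **Load bound.**  A near-complementary pair `{C, ([k]−i)∖C}` is charged with total coefficient `θ_{C+i} + θ_{(([k]−i)∖C)+i} ≤ 1`:
re-inserting the missing point into `C` and into its partner cannot both give the (weakly) smaller side. [this work] -/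
theorem side_insert_add_side_insert_le_one {c : ℕ} (hk : c + 1 ≤ k) :
    (if 2 * (c + 1) < k then (1 : ℝ) else if 2 * (c + 1) = k then 1 / 2 else 0) +
      (if 2 * (k - c) < k then (1 : ℝ) else if 2 * (k - c) = k then 1 / 2 else 0) ≤ 1 := by
  by_cases h1 : 2 * (c + 1) < k
  · rw [if_pos h1, if_neg (by omega), if_neg (by omega)]; norm_num
  · by_cases h2 : 2 * (c + 1) = k
    · rw [if_neg h1, if_pos h2, if_neg (by omega), if_neg (by omega)]; norm_num
    · rw [if_neg h1, if_neg h2]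
      split_ifs <;> norm_num

/-! ### Re-indexing lemmas -/

/-- Blocks through `a` are `insert a` of the subsets of `univ.erase a`. [folklore] -/
theorem sum_filter_mem_eq_sum_powerset_erase_insert {ι : Type*} [Fintype ι] [DecidableEq ι] (a : ι) (g : Finset ι → ℝ) :
    ∑ B ∈ univ.filter (fun B : Finset ι => a ∈ B), g B = ∑ A ∈ (univ.erase a).powerset, g (insert a A) := by
  refine Finset.sum_bij' (fun B _ => B.erase a) (fun A _ => insert a A) ?_ ?_ ?_ ?_ ?_
  · intro B hB
    exact mem_powerset.2 (erase_subset_erase a (subset_univ B))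
  · intro A hA
    exact mem_filter.2 ⟨mem_univ _, mem_insert_self a A⟩
  · intro B hB
    exact insert_erase (mem_filter.1 hB).2
  · intro A hA
    have haA : a ∉ A := fun h => (notMem_erase a univ) (mem_powerset.1 hA h)
    exact erase_insert haA
  · intro B hB
    rw [insert_erase (mem_filter.1 hB).2]

/-- `Σ_B Σ_{i∈B} g(i, B∖i) = Σ_i Σ_{C ⊆ [k]−i} g(i, C)`. [folklore] -/
theorem sum_sum_mem_erase_eq {ι : Type*} [Fintype ι] [DecidableEq ι] (g : ι → Finset ι → ℝ) :
    ∑ B : Finset ι, ∑ i ∈ B, g i (B.erase i) = ∑ i : ι, ∑ C ∈ (univ.erase i).powerset, g i C := by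
  have h1 : ∑ B : Finset ι, ∑ i ∈ B, g i (B.erase i) = ∑ B : Finset ι, ∑ i : ι, if i ∈ B then g i (B.erase i) else 0 := by
    refine sum_congr rfl fun B _ => ?_
    rw [sum_ite_mem, univ_inter]
  rw [h1, sum_comm]
  refine sum_congr rfl fun i _ => ?_
  rw [← sum_filter, sum_filter_mem_eq_sum_powerset_erase_insert i (fun B => g i (B.erase i))]
  refine sum_congr rfl fun C hC => ?_
  have hiC : i ∉ C := fun h => (notMem_erase i univ) (mem_powerset.1 hC h)
  rw [erase_insert hiC]

/-! ### The theorem -/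

/-- **SECOND-ORDER POSITIVITY ON THE ONE-MISSING-FACE CONE (every order).**  Let `x : Finset (Fin k) → ℝ` be nonnegative, vanish on the
sets of size `≥ k − 1`, and satisfy `(|B|−1)·x_B ≤ Σ_{i∈B} x_{B∖i}` whenever `|B| ≥ 2`.  Then the (doubled) complementary sum is at most the
(doubled) near-complementary sum:
`Σ_B (|B|−1)!(|Bᶜ|−1)!·x_B x_{Bᶜ} ≤ Σ_i Σ_{C ⊆ [k]−i} (|C|−1)!(|([k]−i)∖C|−1)!·x_C x_{([k]−i)∖C}`,
i.e. the `ε²`-coefficient of `Φ_k(1 − εx)` is `≥ 0` (memo §3).  No subadditivity is assumed. [this work] -/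
theorem sum_compl_le_sum_near (x : Finset (Fin k) → ℝ) (h0 : ∀ B, 0 ≤ x B) (hbig : ∀ B : Finset (Fin k), k ≤ B.card + 1 → x B = 0)
    (hface : ∀ B : Finset (Fin k), 2 ≤ B.card → ((B.card : ℝ) - 1) * x B ≤ ∑ i ∈ B, x (B.erase i)) :
    ∑ B : Finset (Fin k), ((B.card - 1).factorial : ℝ) * ((Bᶜ.card - 1).factorial : ℝ) * (x B * x Bᶜ) ≤
      ∑ i : Fin k, ∑ C ∈ (univ.erase i).powerset,
        ((C.card - 1).factorial : ℝ) * ((((univ.erase i) \ C).card - 1).factorial : ℝ) * (x C * x ((univ.erase i) \ C)) := by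
  -- notation
  set w : Finset (Fin k) → ℝ := fun B => ((B.card - 1).factorial : ℝ) with hw
  set θ : Finset (Fin k) → ℝ := fun B => if 2 * B.card < k then 1 else if 2 * B.card = k then 1 / 2 else 0 with hθ
  set ch : Finset (Fin k) → ℝ := fun B => ∑ i ∈ B, w (B.erase i) * w Bᶜ * (x (B.erase i) * x Bᶜ) with hch
  have hw0 : ∀ B, 0 ≤ w B := fun B => Nat.cast_nonneg _
  have hch0 : ∀ B, 0 ≤ ch B := fun B => sum_nonneg fun i _ =>
    mul_nonneg (mul_nonneg (hw0 _) (hw0 _)) (mul_nonneg (h0 _) (h0 _))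
  have hθ0 : ∀ B, 0 ≤ θ B := fun B => side_nonneg k B.card
  have hθc : ∀ B : Finset (Fin k), θ B + θ Bᶜ = 1 := by
    intro B
    have hc : Bᶜ.card = k - B.card := by rw [card_compl, Fintype.card_fin]
    have hle : B.card ≤ k := by have := card_le_univ B; rwa [Fintype.card_fin] at this
    simp only [hθ, hc]
    exact side_add_side_compl hle
  -- Step 1: each complementary term is dominated by the side-weighted children
  have step1 : ∀ B : Finset (Fin k), w B * w Bᶜ * (x B * x Bᶜ) ≤ θ B * ch B + θ Bᶜ * ch Bᶜ := by
    intro B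
    by_cases hsmall : B.card ≤ 1 ∨ Bᶜ.card ≤ 1
    · have hz : x B * x Bᶜ = 0 := by
        rcases hsmall with h | h
        · have : x Bᶜ = 0 := hbig _ (by rw [card_compl, Fintype.card_fin]; omega)
          rw [this, mul_zero]
        · have hc : Bᶜ.card = k - B.card := by rw [card_compl, Fintype.card_fin]
          have : x B = 0 := hbig _ (by omega)
          rw [this, zero_mul]
      rw [hz, mul_zero]
      exact add_nonneg (mul_nonneg (hθ0 _) (hch0 _)) (mul_nonneg (hθ0 _) (hch0 _))
    · push Not at hsmall
      have hB2 : 2 ≤ B.card := by omega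
      have hBc2 : 2 ≤ Bᶜ.card := by omega
      -- domination by the children of `B`
      have dB : w B * w Bᶜ * (x B * x Bᶜ) ≤ ch B := by
        have h := weight_mul_le_sum_erase x hB2 (hface B hB2)
        have e : w B * w Bᶜ * (x B * x Bᶜ) = (w B * x B) * (w Bᶜ * x Bᶜ) := by ring
        rw [e, hch]
        simp only
        calc (w B * x B) * (w Bᶜ * x Bᶜ) ≤ (∑ i ∈ B, w (B.erase i) * x (B.erase i)) * (w Bᶜ * x Bᶜ) :=
              mul_le_mul_of_nonneg_right h (mul_nonneg (hw0 _) (h0 _))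
          _ = ∑ i ∈ B, w (B.erase i) * w Bᶜ * (x (B.erase i) * x Bᶜ) := by
              rw [sum_mul]; exact sum_congr rfl fun i _ => by ring
      -- domination by the children of `Bᶜ` (symmetry `Bᶜᶜ = B`)
      have dBc : w B * w Bᶜ * (x B * x Bᶜ) ≤ ch Bᶜ := by
        have h := weight_mul_le_sum_erase x hBc2 (hface Bᶜ hBc2)
        have e : w B * w Bᶜ * (x B * x Bᶜ) = (w Bᶜ * x Bᶜ) * (w B * x B) := by ring
        rw [e, hch]
        simp only [compl_compl]
        calc (w Bᶜ * x Bᶜ) * (w B * x B) ≤ (∑ i ∈ Bᶜ, w (Bᶜ.erase i) * x (Bᶜ.erase i)) * (w B * x B) :=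
              mul_le_mul_of_nonneg_right h (mul_nonneg (hw0 _) (h0 _))
          _ = ∑ i ∈ Bᶜ, w (Bᶜ.erase i) * w B * (x (Bᶜ.erase i) * x B) := by
              rw [sum_mul]; exact sum_congr rfl fun i _ => by ring
      have e : w B * w Bᶜ * (x B * x Bᶜ) = θ B * (w B * w Bᶜ * (x B * x Bᶜ)) + θ Bᶜ * (w B * w Bᶜ * (x B * x Bᶜ)) := by
        rw [← add_mul, hθc, one_mul]
      rw [e]
      exact add_le_add (mul_le_mul_of_nonneg_left dB (hθ0 _)) (mul_le_mul_of_nonneg_left dBc (hθ0 _))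
  -- Step 2: sum, and fold the `Bᶜ`-terms back by the involution `B ↦ Bᶜ`
  have step2 : ∑ B : Finset (Fin k), w B * w Bᶜ * (x B * x Bᶜ) ≤ 2 * ∑ B : Finset (Fin k), θ B * ch B := by
    have hinv : ∑ B : Finset (Fin k), θ Bᶜ * ch Bᶜ = ∑ B : Finset (Fin k), θ B * ch B :=
      Fintype.sum_equiv (Equiv.mk (fun B : Finset (Fin k) => Bᶜ) (fun B => Bᶜ) (fun B => compl_compl B) (fun B => compl_compl B)) _ _
        (fun B => rfl)
    calc ∑ B : Finset (Fin k), w B * w Bᶜ * (x B * x Bᶜ) ≤ ∑ B : Finset (Fin k), (θ B * ch B + θ Bᶜ * ch Bᶜ) := sum_le_sum fun B _ => step1 B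
      _ = ∑ B : Finset (Fin k), θ B * ch B + ∑ B : Finset (Fin k), θ Bᶜ * ch Bᶜ := sum_add_distrib
      _ = 2 * ∑ B : Finset (Fin k), θ B * ch B := by rw [hinv]; ring
  -- Step 3: re-index the children by (missing point, smaller-side remainder)
  set U : Fin k → Finset (Fin k) → ℝ := fun i C =>
    ((C.card - 1).factorial : ℝ) * ((((univ.erase i) \ C).card - 1).factorial : ℝ) * (x C * x ((univ.erase i) \ C)) with hU
  have step3 : ∑ B : Finset (Fin k), θ B * ch B = ∑ i : Fin k, ∑ C ∈ (univ.erase i).powerset, θ (insert i C) * U i C := by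
    have e1 : ∑ B : Finset (Fin k), θ B * ch B = ∑ B : Finset (Fin k), ∑ i ∈ B, θ B * U i (B.erase i) := by
      refine sum_congr rfl fun B _ => ?_
      rw [hch, mul_sum]
      refine sum_congr rfl fun i hi => ?_
      have hc : (univ.erase i) \ B.erase i = Bᶜ := by
        ext y
        simp only [mem_sdiff, mem_erase, ne_eq, mem_univ, and_true, mem_compl]
        constructor
        · rintro ⟨hyi, h⟩ hyB; exact h ⟨hyi, hyB⟩
        · intro hyB; exact ⟨fun h => hyB (h ▸ hi), fun h => hyB h.2⟩
      rw [hU]; simp only [hc, hw]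
    rw [e1]
    have e2 := sum_sum_mem_erase_eq (fun i C => θ (insert i C) * U i C)
    rw [← e2]
    refine sum_congr rfl fun B _ => sum_congr rfl fun i hi => ?_
    rw [insert_erase hi]
  -- Step 4: per missing point, the involution `C ↦ ([k]−i)∖C` and the load bound
  have step4 : ∀ i : Fin k, 2 * ∑ C ∈ (univ.erase i).powerset, θ (insert i C) * U i C ≤ ∑ C ∈ (univ.erase i).powerset, U i C := by
    intro i
    set s := (univ.erase i : Finset (Fin k)) with hs
    have hUsymm : ∀ C ∈ s.powerset, U i (s \ C) = U i C := by
      intro C hC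
      have hCs : C ⊆ s := mem_powerset.1 hC
      rw [hU]; simp only
      rw [Finset.sdiff_sdiff_eq_self hCs]; ring
    have hinv : ∑ C ∈ s.powerset, θ (insert i C) * U i C = ∑ C ∈ s.powerset, θ (insert i (s \ C)) * U i C := by
      refine Finset.sum_bij' (fun C _ => s \ C) (fun C _ => s \ C) ?_ ?_ ?_ ?_ ?_
      · intro C hC; exact mem_powerset.2 sdiff_subset
      · intro C hC; exact mem_powerset.2 sdiff_subset
      · intro C hC; exact Finset.sdiff_sdiff_eq_self (mem_powerset.1 hC)
      · intro C hC; exact Finset.sdiff_sdiff_eq_self (mem_powerset.1 hC)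
      · intro C hC; rw [Finset.sdiff_sdiff_eq_self (mem_powerset.1 hC), hUsymm C hC]
    have e : 2 * ∑ C ∈ s.powerset, θ (insert i C) * U i C = ∑ C ∈ s.powerset, (θ (insert i C) + θ (insert i (s \ C))) * U i C := by
      rw [two_mul]
      nth_rw 1 [hinv]
      rw [← sum_add_distrib]
      exact sum_congr rfl fun C _ => by ring
    rw [e]
    refine sum_le_sum fun C hC => ?_
    have hCs : C ⊆ s := mem_powerset.1 hC
    have hiC : i ∉ C := fun h => (notMem_erase i univ) (hCs h)
    have hisC : i ∉ s \ C := fun h => (notMem_erase i univ) (sdiff_subset h)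
    have hscard : s.card = k - 1 := by rw [hs, card_erase_of_mem (mem_univ _), card_univ, Fintype.card_fin]
    have hCle : C.card ≤ k - 1 := hscard ▸ card_le_card hCs
    have hk1 : 1 ≤ k := Fin.pos i
    have hU0 : 0 ≤ U i C := by
      rw [hU]; exact mul_nonneg (mul_nonneg (Nat.cast_nonneg _) (Nat.cast_nonneg _)) (mul_nonneg (h0 _) (h0 _))
    have hload : θ (insert i C) + θ (insert i (s \ C)) ≤ 1 := by
      rw [hθ]; simp only
      rw [card_insert_of_notMem hiC, card_insert_of_notMem hisC, card_sdiff_of_subset hCs, hscard]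
      have e3 : k - 1 - C.card + 1 = k - C.card := by omega
      rw [e3]
      exact side_insert_add_side_insert_le_one (by omega)
    calc (θ (insert i C) + θ (insert i (s \ C))) * U i C ≤ 1 * U i C := mul_le_mul_of_nonneg_right hload hU0
      _ = U i C := one_mul _
  -- assemble
  calc ∑ B : Finset (Fin k), w B * w Bᶜ * (x B * x Bᶜ)
      ≤ 2 * ∑ B : Finset (Fin k), θ B * ch B := step2
    _ = ∑ i : Fin k, 2 * ∑ C ∈ (univ.erase i).powerset, θ (insert i C) * U i C := by rw [step3, mul_sum]
    _ ≤ ∑ i : Fin k, ∑ C ∈ (univ.erase i).powerset, U i C := sum_le_sum fun i _ => step4 i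

end PhiSecondOrder

end Summit.CriticalPhenomena.PercolationContinuityZ3.Theorems
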